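import Summits.RiemannHypothesis.RiemannHypothesis.Theorems.GroundBartaEvenWinsBeyondArchDeflationCore
import Summits.RiemannHypothesis.RiemannHypothesis.Theorems.GroundBartaEvenWinsBeyondArchDeflationTransfer
import Summits.RiemannHypothesis.RiemannHypothesis.Theorems.OddSectorOddOneSignedWindowsRealPart
import HarnessLib

/-!
# RiemannHypothesis / GroundBarta — rung 4 (`EvenWinsBeyondArch`, stmt-RiemannHypothesis-18807):
# the deflated Temple (Lehmann–Maehly) L-side programme, IV — certified lower bounds for the sector bottoms
# `ε_ev(c)`, `ε_od(c)` from Ritz data and a low-precision complement certificate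

Helper file (`--supports stmt-RiemannHypothesis-18807`), RH-free, Mathlib + landed tree files only, no
definitions, no named facts.

THE L-SIDE THEOREM of the deflated Temple programme (A's HANDOFF §farm goal G1; FEASIBILITY-234 v2–v4 on items
18085/18807).  For a window `c > 0` and a sector (even: `dt_weilEvenGroundEnergy_ge_of_deflation`; odd:
`dt_weilOddGroundEnergy_ge_of_deflation`; both from the parity-`σ` master `dt_sector_bound`) the inputs are

* `k` real trial vectors `v_i` in the sector form domain of the window (`L²`, zero off `[-c, c]`, real-valued,
  sector parity, finite archimedean energy `∫₀^∞ ρ(t) D_t(v_i) dt < ∞`) — e.g. polynomial × indicator Ritz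
  vectors — together with their WINDOW IMAGES `F_i ∈ L²`:
  `P(v_i, f) + 𝓔_c(v_i, f) − M_c ∫Re(v_i f̄) = ∫ Re(F_i f̄)` for every `f` in the sector form domain;
* a coefficient matrix `W` (residuals `r_i = F_i − Σ_l W_il v_l`; any `W` — the `L²`-projection is optimal);
* a LOW-PRECISION CERTIFICATE `β ∫|φ|² ≤ Re Q(φ) + Σ_i μ_i |∫ φ v̄_i|²` on smooth sector tests supported in
  `[-c, c]`, `μ_i ≥ 0` (Yoshida's moment format augmented by `k` rank-one forms);
* `λ < β` and positive semidefiniteness of the `k × k` matrix `(β − λ)(A − λG) − R`,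
  `A_ij = P(v_i, v_j) + 𝓔_c(v_i, v_j) − M_c G_ij`, `G_ij = ∫ Re(v_i v̄_j)`, `R_ij = ∫ Re(r_i r̄_j)`
  (a finite inequality on explicit integrals, to be settled by exact/interval arithmetic);

and the output is `λ ≤ ε_sector(c)`.  NO adversarial `T`-tail of an unknown near-minimiser enters: the precision
wall of the moment certificates (`c ≈ 0.75`) is gone; the measured demand (A's kit jobs j039260/j040304) is met at
`c = log 2` by `N = 26–40` Legendre Ritz vectors with `β ≈ 0.3–0.6` (even bottom `≥ 4–7e-13 > 0`, odd `≥ 4e-10`).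

Chain: reduce a complex sector test to its real and imaginary parts (`Re Q(g) = Re Q(Re g) + Re Q(Im g)`,
`OddSector.re_weilQuadratic_eq_rePart_add_imPart`); for a real sector test apply the inclusion on the sector form
domain (`dt_deflation_core`, file III) whose complement hypothesis is the transferred certificate
(`dt_beta_transfer`, file II) and whose diagonal is `Re Q` (Bombieri's Markov decomposition); take the infimum.
Prover B, speedrun unit `sr-gb-rung-b` (gen 3).

References: A. Weinstein, W. Stenger, *Methods of Intermediate Problems for Eigenvalues* (1972) Ch. 5 §9;
M. Reed, B. Simon, *Methods of Modern Mathematical Physics IV* (1978) Thm XIII.5; E. Bombieri, Rend. Mat. Acc.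
Lincei (9) 11 (2000) 183–233, Thm 2, §4; H. Yoshida, Adv. Stud. Pure Math. 21 (1992) Thm 1.
-/

set_option linter.dupNamespace false

noncomputable section

open MeasureTheory Set Filter
open scoped Topology ENNReal NNReal ComplexConjugate BigOperators

namespace Summit.RiemannHypothesis.RiemannHypothesis.Theorems.EvenWinsBeyondArch

open Literature.NumberTheory.LFunctions Literature.NumberTheory.LFunctions.ConnesVanSuijlekom
open Summit.RiemannHypothesis.RiemannHypothesis.Theorems.OddSector
  (weilIncrement₂ weilDirichletEnergy₂ weilPoleForm₂ weilIncrement₂_self weilDirichletEnergy₂_self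
    weilPoleForm₂_self re_mul_conj_self isWeilTest_rePart isWeilTest_imPart tsupport_rePart_subset
    tsupport_imPart_subset integral_norm_sq_rePart_add_imPart re_weilQuadratic_eq_rePart_add_imPart)

/-! ## Real/complex orthogonality bookkeeping -/

/-- For real-valued `h, v ∈ L²`, the complex pairing `∫ h v̄` vanishes as soon as the real pairing
`∫ Re(v h̄)` does. -/
theorem dt_integral_mul_conj_eq_zero_of_real {h v : ℝ → ℂ} (hh : MemLp h 2) (hv : MemLp v 2)
    (hhr : ∀ x, (h x).im = 0) (hvr : ∀ x, (v x).im = 0) (h0 : ∫ x, (v x * conj (h x)).re = 0) :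
    ∫ x, h x * conj (v x) = 0 := by
  have hint : Integrable fun x ↦ h x * conj (v x) := hh.integrable_mul (memLp_conj hv)
  apply Complex.ext
  · have h1 := integral_re hint
    simp only [RCLike.re_to_complex] at h1
    rw [Complex.zero_re, ← h1, ← h0]
    congr 1 with x
    simp only [Complex.mul_re, Complex.conj_re, Complex.conj_im]
    ring
  · have h1 := integral_im hint
    simp only [RCLike.im_to_complex] at h1
    rw [Complex.zero_im, ← h1]
    refine integral_eq_zero_of_ae (Eventually.of_forall fun x ↦ ?_)
    simp [Complex.mul_im, hhr x, hvr x]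

/-! ## The master bound for a parity sector -/

/-- **Deflated Temple bound on smooth sector tests (parity `σ = ±1`).**  Under the inputs of the module
docstring — trial vectors `v_i` in the sector form domain with window images `F_i`, residual coefficients `W`,
a low-precision certificate `(β, μ)` on smooth sector tests, `λ < β`, and the PSD condition — every smooth test
`g` supported in `[-c, c]` with `g(-x) = σ g(x)` satisfies `λ ∫|g|² ≤ Re Q(g)`.
[cite: WeinsteinStenger1972, Ch. 5 §9 eq. (2) (k = 1: Temple's formula)] -/
theorem dt_sector_bound {c : ℝ} (hc : 0 < c) (σ : ℝ) {k : ℕ} (v F : Fin k → ℝ → ℂ)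
    (W : Fin k → Fin k → ℝ) (μ : Fin k → ℝ) {β lam : ℝ} (hlam : lam < β) (hμ : ∀ i, 0 ≤ μ i)
    (hv : ∀ i, MemLp (v i) 2 ∧ (∀ x, x ∉ Icc (-c) c → v i x = 0) ∧ (∀ x, (v i x).im = 0) ∧
      (∀ x, v i (-x) = (σ : ℂ) * v i x) ∧
      IntegrableOn (fun t ↦ weilArchDensity t * weilIncrement (v i) t) (Ioi 0))
    (hF : ∀ i, MemLp (F i) 2)
    (hrepr : ∀ i (f : ℝ → ℂ), MemLp f 2 → (∀ x, x ∉ Icc (-c) c → f x = 0) → (∀ x, (f x).im = 0) →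
      (∀ x, f (-x) = (σ : ℂ) * f x) →
      IntegrableOn (fun t ↦ weilArchDensity t * weilIncrement f t) (Ioi 0) →
      weilPoleForm₂ (v i) f + weilDirichletEnergy₂ c (v i) f -
          weilMarkovConstant c * ∫ x, (v i x * conj (f x)).re = ∫ x, (F i x * conj (f x)).re)
    (hcert : ∀ φ : ℝ → ℂ, IsWeilTest φ → tsupport φ ⊆ Icc (-c) c → (∀ x, φ (-x) = (σ : ℂ) * φ x) →
      β * ∫ x, ‖φ x‖ ^ 2 ≤ (weilQuadratic φ).re + ∑ i, μ i * ‖∫ x, φ x * conj (v i x)‖ ^ 2)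
    (hPSD : ∀ α : Fin k → ℝ, 0 ≤ ∑ i, ∑ j, α i * α j *
      ((β - lam) * ((weilPoleForm₂ (v i) (v j) + weilDirichletEnergy₂ c (v i) (v j) -
          weilMarkovConstant c * ∫ x, (v i x * conj (v j x)).re) - lam * ∫ x, (v i x * conj (v j x)).re) -
        ∫ x, ((F i - ∑ l, W i l • v l) x * conj ((F j - ∑ l, W j l • v l) x)).re))
    {g : ℝ → ℂ} (hg : IsWeilTest g) (hgs : tsupport g ⊆ Icc (-c) c)
    (hgp : ∀ x, g (-x) = (σ : ℂ) * g x) :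
    lam * ∫ x, ‖g x‖ ^ 2 ≤ (weilQuadratic g).re := by
  -- the complement bound on the sector form domain, transferred from the certificate
  have hbeta : ∀ h : ℝ → ℂ, MemLp h 2 → (∀ x, x ∉ Icc (-c) c → h x = 0) → (∀ x, (h x).im = 0) →
      (∀ x, h (-x) = (σ : ℂ) * h x) →
      IntegrableOn (fun t ↦ weilArchDensity t * weilIncrement h t) (Ioi 0) →
      (∀ j, ∫ x, (v j x * conj (h x)).re = 0) →
      β * ∫ x, ‖h x‖ ^ 2 ≤
        weilPoleForm h + weilDirichletEnergy c h - weilMarkovConstant c * ∫ x, ‖h x‖ ^ 2 := by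
    intro h hh hhs hhr hhp hhE h0
    exact dt_beta_transfer hc (σ : ℂ) v (fun i ↦ (hv i).1) μ hμ hcert hh hhs hhp hhE
      fun i ↦ dt_integral_mul_conj_eq_zero_of_real hh (hv i).1 hhr (hv i).2.2.1 (h0 i)
  -- the bound for REAL sector tests in the window
  have hreal : ∀ r : ℝ → ℂ, IsWeilTest r → tsupport r ⊆ Icc (-c) c → (∀ x, (r x).im = 0) →
      (∀ x, r (-x) = (σ : ℂ) * r x) → lam * ∫ x, ‖r x‖ ^ 2 ≤ (weilQuadratic r).re := by
    intro r hr hrs hrr hrp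
    have hrs' : ∀ x, x ∉ Icc (-c) c → r x = 0 := fun x hx ↦
      image_eq_zero_of_notMem_tsupport fun hm ↦ hx (hrs hm)
    have h := dt_deflation_core (σ : ℂ) v F W hlam hv hF hrepr hbeta hPSD hr.memLp_two hrs' hrr hrp
      (integrableOn_weilArchDensity_mul_weilIncrement hr)
    rwa [← weilQuadratic_re_eq_weilPoleForm_add_weilDirichletEnergy_sub hr hrs] at h
  -- split `g` into real and imaginary parts
  set gR : ℝ → ℂ := fun x ↦ ((g x).re : ℂ) with hgR
  set gI : ℝ → ℂ := fun x ↦ ((g x).im : ℂ) with hgI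
  have hR := hreal gR (isWeilTest_rePart hg) ((tsupport_rePart_subset g).trans hgs)
    (fun x ↦ by simp [hgR]) (fun x ↦ by simp [hgR, hgp x])
  have hI := hreal gI (isWeilTest_imPart hg) ((tsupport_imPart_subset g).trans hgs)
    (fun x ↦ by simp [hgI]) (fun x ↦ by simp [hgI, hgp x])
  rw [re_weilQuadratic_eq_rePart_add_imPart hg, ← integral_norm_sq_rePart_add_imPart hg.memLp_two]
  simp only [hgR, hgI] at hR hI
  linarith

/-! ## The even and odd sector bottoms -/

/-- **Deflated Temple (Lehmann–Maehly) lower bound for the even-sector bottom `ε_ev(c)`.**  Let `c > 0`;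
`v₁ … v_k` even real trial vectors in the form domain of the window with window images `F_i ∈ L²`
(`P(v_i, f) + 𝓔_c(v_i, f) − M_c∫Re(v_i f̄) = ∫Re(F_i f̄)` for every even real finite-energy window function
`f`); `W` any residual coefficient matrix; `(β, μ)` a certificate `β ∫|φ|² ≤ Re Q(φ) + Σ μ_i |∫ φ v̄_i|²` on
smooth even tests supported in `[-c, c]`, `μ_i ≥ 0`; `λ < β`; and `(β − λ)(A − λG) − R ⪰ 0`.  Then
`λ ≤ ε_ev(c) = weilEvenGroundEnergy c`. [cite: WeinsteinStenger1972, Ch. 5 §9 eq. (2) (k = 1: Temple's formula)] -/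
theorem dt_weilEvenGroundEnergy_ge_of_deflation {c : ℝ} (hc : 0 < c) {k : ℕ} (v F : Fin k → ℝ → ℂ)
    (W : Fin k → Fin k → ℝ) (μ : Fin k → ℝ) {β lam : ℝ} (hlam : lam < β) (hμ : ∀ i, 0 ≤ μ i)
    (hv : ∀ i, MemLp (v i) 2 ∧ (∀ x, x ∉ Icc (-c) c → v i x = 0) ∧ (∀ x, (v i x).im = 0) ∧
      (∀ x, v i (-x) = v i x) ∧ IntegrableOn (fun t ↦ weilArchDensity t * weilIncrement (v i) t) (Ioi 0))
    (hF : ∀ i, MemLp (F i) 2)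
    (hrepr : ∀ i (f : ℝ → ℂ), MemLp f 2 → (∀ x, x ∉ Icc (-c) c → f x = 0) → (∀ x, (f x).im = 0) →
      (∀ x, f (-x) = f x) → IntegrableOn (fun t ↦ weilArchDensity t * weilIncrement f t) (Ioi 0) →
      weilPoleForm₂ (v i) f + weilDirichletEnergy₂ c (v i) f -
          weilMarkovConstant c * ∫ x, (v i x * conj (f x)).re = ∫ x, (F i x * conj (f x)).re)
    (hcert : ∀ φ : ℝ → ℂ, IsWeilTest φ → tsupport φ ⊆ Icc (-c) c → (∀ x, φ (-x) = φ x) →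
      β * ∫ x, ‖φ x‖ ^ 2 ≤ (weilQuadratic φ).re + ∑ i, μ i * ‖∫ x, φ x * conj (v i x)‖ ^ 2)
    (hPSD : ∀ α : Fin k → ℝ, 0 ≤ ∑ i, ∑ j, α i * α j *
      ((β - lam) * ((weilPoleForm₂ (v i) (v j) + weilDirichletEnergy₂ c (v i) (v j) -
          weilMarkovConstant c * ∫ x, (v i x * conj (v j x)).re) - lam * ∫ x, (v i x * conj (v j x)).re) -
        ∫ x, ((F i - ∑ l, W i l • v l) x * conj ((F j - ∑ l, W j l • v l) x)).re)) :
    lam ≤ weilEvenGroundEnergy c := by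
  refine le_weilEvenGroundEnergy_of_forall hc fun g hg hgs hge hgn ↦ ?_
  have h := dt_sector_bound hc 1 v F W μ hlam hμ
    (fun i ↦ ⟨(hv i).1, (hv i).2.1, (hv i).2.2.1, fun x ↦ by simpa using (hv i).2.2.2.1 x, (hv i).2.2.2.2⟩)
    hF (fun i f hf hfs hfr hfp hfE ↦ hrepr i f hf hfs hfr (fun x ↦ by simpa using hfp x) hfE)
    (fun φ hφ hφs hφp ↦ hcert φ hφ hφs (fun x ↦ by simpa using hφp x)) hPSD hg hgs
    (fun x ↦ by simpa using hge x)
  rwa [hgn, mul_one] at h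

/-- **Deflated Temple (Lehmann–Maehly) lower bound for the odd-sector bottom `ε_od(c)`** — the L-side of the
parity ladder's window cells (item 18085 / 18807) — same inputs in the odd sector: `λ ≤ weilOddGroundEnergy c`.
[cite: WeinsteinStenger1972, Ch. 5 §9 eq. (2) (k = 1: Temple's formula)] -/
theorem dt_weilOddGroundEnergy_ge_of_deflation {c : ℝ} (hc : 0 < c) {k : ℕ} (v F : Fin k → ℝ → ℂ)
    (W : Fin k → Fin k → ℝ) (μ : Fin k → ℝ) {β lam : ℝ} (hlam : lam < β) (hμ : ∀ i, 0 ≤ μ i)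
    (hv : ∀ i, MemLp (v i) 2 ∧ (∀ x, x ∉ Icc (-c) c → v i x = 0) ∧ (∀ x, (v i x).im = 0) ∧
      (∀ x, v i (-x) = -v i x) ∧ IntegrableOn (fun t ↦ weilArchDensity t * weilIncrement (v i) t) (Ioi 0))
    (hF : ∀ i, MemLp (F i) 2)
    (hrepr : ∀ i (f : ℝ → ℂ), MemLp f 2 → (∀ x, x ∉ Icc (-c) c → f x = 0) → (∀ x, (f x).im = 0) →
      (∀ x, f (-x) = -f x) → IntegrableOn (fun t ↦ weilArchDensity t * weilIncrement f t) (Ioi 0) →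
      weilPoleForm₂ (v i) f + weilDirichletEnergy₂ c (v i) f -
          weilMarkovConstant c * ∫ x, (v i x * conj (f x)).re = ∫ x, (F i x * conj (f x)).re)
    (hcert : ∀ φ : ℝ → ℂ, IsWeilTest φ → tsupport φ ⊆ Icc (-c) c → (∀ x, φ (-x) = -φ x) →
      β * ∫ x, ‖φ x‖ ^ 2 ≤ (weilQuadratic φ).re + ∑ i, μ i * ‖∫ x, φ x * conj (v i x)‖ ^ 2)
    (hPSD : ∀ α : Fin k → ℝ, 0 ≤ ∑ i, ∑ j, α i * α j *
      ((β - lam) * ((weilPoleForm₂ (v i) (v j) + weilDirichletEnergy₂ c (v i) (v j) -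
          weilMarkovConstant c * ∫ x, (v i x * conj (v j x)).re) - lam * ∫ x, (v i x * conj (v j x)).re) -
        ∫ x, ((F i - ∑ l, W i l • v l) x * conj ((F j - ∑ l, W j l • v l) x)).re)) :
    lam ≤ weilOddGroundEnergy c := by
  refine le_weilOddGroundEnergy_of_forall hc fun g hg hgs hgo hgn ↦ ?_
  have h := dt_sector_bound hc (-1) v F W μ hlam hμ
    (fun i ↦ ⟨(hv i).1, (hv i).2.1, (hv i).2.2.1, fun x ↦ by simpa using (hv i).2.2.2.1 x, (hv i).2.2.2.2⟩)
    hF (fun i f hf hfs hfr hfp hfE ↦ hrepr i f hf hfs hfr (fun x ↦ by simpa using hfp x) hfE)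
    (fun φ hφ hφs hφp ↦ hcert φ hφ hφs (fun x ↦ by simpa using hφp x)) hPSD hg hgs
    (fun x ↦ by simpa using hgo x)
  rwa [hgn, mul_one] at h

/-- **Temple's inequality for the even bottom (`k = 1`, one normalised trial vector).**  With a single even
real trial vector `v` of unit norm (`∫|v|² = 1`), Rayleigh value `ρ = P(v) + 𝓔_c(v) − M_c`, window image `F`,
residual `r = F − w v` for any real `w` with `∫|r|² ≤ s`, a certificate `(β, μ)` on smooth even tests and
`λ < β` with `s ≤ (β − λ)(ρ − λ)`: `λ ≤ ε_ev(c)` — Kato's form `ε ≥ ρ − σ²/(β − ρ)` of Temple's inequality.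
[cite: ReedSimonIV1978, Thm. XIII.5] -/
theorem dt_weilEvenGroundEnergy_ge_temple {c : ℝ} (hc : 0 < c) (v F : ℝ → ℂ) (w μ : ℝ)
    {β lam ρ s : ℝ} (hlam : lam < β) (hμ : 0 ≤ μ)
    (hv : MemLp v 2 ∧ (∀ x, x ∉ Icc (-c) c → v x = 0) ∧ (∀ x, (v x).im = 0) ∧
      (∀ x, v (-x) = v x) ∧ IntegrableOn (fun t ↦ weilArchDensity t * weilIncrement v t) (Ioi 0))
    (hvN : ∫ x, ‖v x‖ ^ 2 = 1) (hF : MemLp F 2)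
    (hρ : weilPoleForm v + weilDirichletEnergy c v - weilMarkovConstant c = ρ)
    (hrepr : ∀ f : ℝ → ℂ, MemLp f 2 → (∀ x, x ∉ Icc (-c) c → f x = 0) → (∀ x, (f x).im = 0) →
      (∀ x, f (-x) = f x) → IntegrableOn (fun t ↦ weilArchDensity t * weilIncrement f t) (Ioi 0) →
      weilPoleForm₂ v f + weilDirichletEnergy₂ c v f -
          weilMarkovConstant c * ∫ x, (v x * conj (f x)).re = ∫ x, (F x * conj (f x)).re)
    (hcert : ∀ φ : ℝ → ℂ, IsWeilTest φ → tsupport φ ⊆ Icc (-c) c → (∀ x, φ (-x) = φ x) →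
      β * ∫ x, ‖φ x‖ ^ 2 ≤ (weilQuadratic φ).re + μ * ‖∫ x, φ x * conj (v x)‖ ^ 2)
    (hs : ∫ x, ‖(F - w • v) x‖ ^ 2 ≤ s) (hcond : s ≤ (β - lam) * (ρ - lam)) :
    lam ≤ weilEvenGroundEnergy c := by
  refine dt_weilEvenGroundEnergy_ge_of_deflation hc (k := 1) (fun _ ↦ v) (fun _ ↦ F) (fun _ _ ↦ w)
    (fun _ ↦ μ) hlam (fun _ ↦ hμ) (fun _ ↦ hv) (fun _ ↦ hF) (fun _ ↦ hrepr) ?_ ?_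
  · intro φ hφ hφs hφp
    have h := hcert φ hφ hφs hφp
    simpa only [Finset.univ_unique, Fin.default_eq_zero, Finset.sum_singleton] using h
  · intro α
    have hG : ∫ x, (v x * conj (v x)).re = 1 := by rw [dt_pairing_self, hvN]
    have hA : weilPoleForm₂ v v + weilDirichletEnergy₂ c v v - weilMarkovConstant c = ρ := by
      rw [weilPoleForm₂_self, weilDirichletEnergy₂_self]; exact hρ
    have hR : ∫ x, ((F - w • v) x * conj ((F - w • v) x)).re ≤ (β - lam) * (ρ - lam) := by
      rw [dt_pairing_self]; exact hs.trans hcond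
    simp only [Finset.univ_unique, Fin.default_eq_zero, Finset.sum_singleton, hG, mul_one, hA]
    exact mul_nonneg (mul_self_nonneg _) (by linarith)

end Summit.RiemannHypothesis.RiemannHypothesis.Theorems.EvenWinsBeyondArch

end
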